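import Summits.BirchSwinnertonDyer.BirchSwinnertonDyer.Theorems.PrintCFramBottomClassIndexLawFiveLeOffLocusDictionary
import HarnessLib

/-!
# Crux `PrintCFram.BottomClassIndexLawFiveLe` (stmt-BirchSwinnertonDyer-20372), line `eisenstein-resource-bdp-line` (registry v17):
# THE `K''`-FACTOR IS THE CLASS FACTOR OF THE HEEGNER TWIST — `B_{1,ψ'⁻¹} = B_{1,(ψε_Kω⁻¹)~}` for every odd datum `ψ'` of `W^{(d_K)}`
# (cell `bsd-print-cfram`, width seat `bsd-line-cfram-p1-w3` g7; THEOREMS ONLY, `--supports` 20372; BSD is not proved by any of this)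

HONEST FRAMING. Nothing here is a statement about BSD; the crux C2 stays OPEN; no stub is closed. LEAD g10's remark (report-lead-g10
ADDENDUM): for the class's odd `ψ` and an imaginary quadratic `K` (so `ε_K` is odd), the twist `W^{(d_K)}` has the Kriz–Li pair
`{ψε_K, ψ⁻¹ε_Kω}` whose ODD member is `ψ⁻¹ε_Kω`; hence its CLASS factor is `B_{1,(ψ⁻¹ε_Kω)⁻¹} = B_{1,ψε_Kω⁻¹}` — the `K`-factor of
`(W, K)` in Kriz–Li's hypothesis (4). This file proves that dictionary as a kernel identity:

* `traceForm_congr_evenTwist_of_hss_twist` — the trace forms of `ψ·ε_K↑` (level `f·|d_K|`) and of any datum `ψ'` with `hss` for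
  `W.quadraticTwist d_K` agree modulo `p` at every prime `ℓ ∤ 2·p·|d_K|·f·f'·N_W·N_{W^{(d_K)}}` (`a_ℓ(W^{(d)}) = (d/ℓ)·a_ℓ(W)` at an odd
  prime `ℓ ∤ d` — Mathlib-level `LFunction_quadraticTwist_intCast_apply_prime_of_not_dvd`, NO reduction hypothesis — and
  `(d_K/ℓ) = ε_K(ℓ)` by the splitting law `Quadratic.ncard_primesOver_eq_two_iff_legendreSym`);
* **`classFactor_twist_eq_fieldFactor`** — for `W/ℚ` elliptic, `p ≥ 5`, an odd datum `(f, ψ, ω)` with `hss` for `W`, an imaginary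
  quadratic `K` with Kronecker character `ε_K`, and ANY odd datum `(f', ψ', ω')` with `hss` for `W.quadraticTwist (d_K : ℚ)`:
  `bernoulliOnePrim ψ'⁻¹ = bernoulliOnePrim (bernoulliCharTwo ψ ε_K ω)`. Uniqueness of the Eisenstein pair
  (`EisensteinPair.eq_or_eq_of_traceForm_congr`, valid for ANY exceptional modulus `N`) leaves `ψ'↑ = (ψε_K)↑` or
  `ψ'↑ = (ψε_K)⁻¹↑ω↑`; parity kills the first (`ψ'` odd, `ψε_K` even); the second inverts to `ψ'⁻¹↑ = (ψε_Kω⁻¹)↑ = (ψ₀ω⁻¹)↑` and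
  `bernoulliOnePrim` only sees the primitive character (`RegularLocusBernoulliPair.bernoulliOnePrim_changeLevel`). No Heegner
  hypothesis, no global minimality, no primitivity.

So registry v17's B2′ («unit class factor but every admissible Heegner `K''`-factor a non-unit») reads: «`W` Eisenstein-regular at `p`
but EVERY admissible Heegner twist `W^{(d_{K''})}` Eisenstein-irregular» — a statement about the class factors of the twist family.
beyond-print theorem: NO (dictionary). BSD is not proved by any of this; no summit statement is proved by this seat.

References: [KrizLi2019] Thm. 1.20 (pp. 7–8), §2 (pp. 11–12), §7.1 (p. 43); [SilvermanAEC2009] X.2 Prop. 2.4, Ex. 10.16;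
[Cox2013] §1.C Lemma 1.14; [CurtisReiner1962] (30.16).
-/

set_option autoImplicit false
-- summit-side namespace `Summit.BirchSwinnertonDyer.BirchSwinnertonDyer.…` (single-conjunct summit, D-0017 layout)
set_option linter.dupNamespace false

noncomputable section

open scoped Classical NumberTheorySymbols
open NumberField DirichletCharacter WeierstrassCurve IsDedekindDomain
open Literature.NumberTheory.EllipticCurves Literature.NumberTheory.EllipticCurves.KrizLi2019
  Literature.NumberTheory.EllipticCurves.Rank1Residual Literature.NumberTheory.QuadraticFields

namespace Summit.BirchSwinnertonDyer.BirchSwinnertonDyer.Theorems.PrintCFram.OffLocusTwistFactor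

open Summit.BirchSwinnertonDyer.BirchSwinnertonDyer.Theorems.PrintCFram
open Summit.BirchSwinnertonDyer.BirchSwinnertonDyer.Theorems.PrintCFram.OffLocusDictionary

variable {p : ℕ} [hp : Fact p.Prime]

/-- **`a_ℓ(W^{(d_K)}) = ε_K(ℓ)·a_ℓ(W)` at every odd prime `ℓ ∤ d_K`**, for an imaginary (indeed any) quadratic field `K` and its
Kronecker character read through `IsKroneckerCharacterOf`: the twist coefficient is `(d_K/ℓ)·a_ℓ(W)` (no reduction hypothesis) and
`(d_K/ℓ) = +1` iff `ℓ` splits in `K`. [cite: SilvermanAEC2009, X.2 Prop. 2.4 and Exercise 10.16] [cite: Cox2013, §1.C Lemma 1.14] -/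
theorem lFunction_twist_discr_eq_kronecker_mul (W : WeierstrassCurve ℚ) [W.IsElliptic]
    (K : Type) [Field K] [NumberField K] (hK2 : Module.finrank ℚ K = 2)
    (εK : DirichletCharacter ℚ_[p] (NumberField.discr K).natAbs) (hεK : IsKroneckerCharacterOf K εK)
    (ℓ : ℕ) (hℓ : ℓ.Prime) (hℓ2 : ℓ ≠ 2) (hℓd : ¬ ((ℓ : ℤ) ∣ NumberField.discr K)) :
    (((W.quadraticTwist (NumberField.discr K : ℚ)).LFunction ℓ : ℤ) : ℚ_[p]) =
      εK (ℓ : ZMod (NumberField.discr K).natAbs) * ((W.LFunction ℓ : ℤ) : ℚ_[p]) := by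
  haveI := Fact.mk hℓ
  set v : HeightOneSpectrum (𝓞 ℚ) := (Rat.HeightOneSpectrum.primesEquiv (R := 𝓞 ℚ)).symm ⟨ℓ, hℓ⟩ with hvdef
  have hv : (Rat.HeightOneSpectrum.primesEquiv v : ℕ) = ℓ := by rw [hvdef, Equiv.apply_symm_apply]
  have htw := W.LFunction_quadraticTwist_intCast_apply_prime_of_not_dvd (NumberField.discr K) v (by rw [hv]; exact hℓ2)
    (by rw [hv]; exact hℓd)
  rw [hv] at htw
  rw [htw, Int.cast_mul]
  congr 1
  -- `J(d_K | ℓ) = ε_K(ℓ)`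
  rw [← jacobiSym.legendreSym.to_jacobiSym, hεK.2 ℓ hℓ hℓd]
  have hd0 : ((NumberField.discr K : ℤ) : ZMod ℓ) ≠ 0 := by
    rwa [Ne, ZMod.intCast_zmod_eq_zero_iff_dvd]
  rcases legendreSym.eq_one_or_neg_one ℓ hd0 with h1 | h1
  · rw [h1, if_pos ((Quadratic.ncard_primesOver_eq_two_iff_legendreSym hK2 hℓ2).mpr h1), Int.cast_one]
  · have hs : ((Ideal.span {(ℓ : ℤ)}).primesOver (𝓞 K)).ncard ≠ 2 := fun hs => by
      have := (Quadratic.ncard_primesOver_eq_two_iff_legendreSym hK2 hℓ2).mp hs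
      rw [h1] at this; norm_num at this
    rw [h1, if_neg hs, Int.cast_neg, Int.cast_one]

/-- **The two trace forms agree.** For `ψ` with `hss` for `W`, `ε_K` Kronecker of a quadratic `K`, and any `ψ'` with `hss` (same
Teichmüller `ω`) for `W.quadraticTwist d_K`: the trace forms of `ψ↑·ε_K↑` (level `f·|d_K|`) and of `ψ'` are congruent modulo `p`
at every prime `ℓ` not dividing `N = 2·p·|d_K|·f·f'·N_W·N_{W^{(d_K)}}`. [cite: KrizLi2019, §2 (p. 11) and §7.1 (p. 43)] -/
theorem traceForm_congr_evenTwist_of_hss_twist (W : WeierstrassCurve ℚ) [W.IsElliptic]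
    (K : Type) [Field K] [NumberField K] (hK2 : Module.finrank ℚ K = 2)
    {f f' : ℕ} [NeZero f] [NeZero f'] (ψ : DirichletCharacter ℚ_[p] f) (ψ' : DirichletCharacter ℚ_[p] f')
    (ω : DirichletCharacter ℚ_[p] p)
    (εK : DirichletCharacter ℚ_[p] (NumberField.discr K).natAbs) (hεK : IsKroneckerCharacterOf K εK)
    (hss : ∀ ℓ : ℕ, ℓ.Prime → ¬ (ℓ ∣ p * W.conductorNorm ℤ) →
      ‖((W.LFunction ℓ : ℤ) : ℚ_[p]) - (ψ (ℓ : ZMod f) + ψ⁻¹ (ℓ : ZMod f) * ω (ℓ : ZMod p))‖ < 1)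
    (hss' : ∀ ℓ : ℕ, ℓ.Prime → ¬ (ℓ ∣ p * (W.quadraticTwist (NumberField.discr K : ℚ)).conductorNorm ℤ) →
      ‖(((W.quadraticTwist (NumberField.discr K : ℚ)).LFunction ℓ : ℤ) : ℚ_[p]) -
        (ψ' (ℓ : ZMod f') + ψ'⁻¹ (ℓ : ZMod f') * ω (ℓ : ZMod p))‖ < 1) :
    ∀ ℓ : ℕ, ℓ.Prime →
      ¬ ℓ ∣ 2 * p * (NumberField.discr K).natAbs * f * f' * W.conductorNorm ℤ *
          (W.quadraticTwist (NumberField.discr K : ℚ)).conductorNorm ℤ →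
      ‖((changeLevel (dvd_mul_right f (NumberField.discr K).natAbs) ψ *
            changeLevel (dvd_mul_left (NumberField.discr K).natAbs f) εK) (ℓ : ZMod (f * (NumberField.discr K).natAbs)) +
          (changeLevel (dvd_mul_right f (NumberField.discr K).natAbs) ψ *
            changeLevel (dvd_mul_left (NumberField.discr K).natAbs f) εK)⁻¹ (ℓ : ZMod (f * (NumberField.discr K).natAbs)) *
          ω (ℓ : ZMod p)) -
        (ψ' (ℓ : ZMod f') + ψ'⁻¹ (ℓ : ZMod f') * ω (ℓ : ZMod p))‖ < 1 := by
  intro ℓ hℓ hℓN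
  -- the prime `ℓ` avoids every factor of `N`
  have hℓ2 : ℓ ≠ 2 := by
    rintro rfl
    exact hℓN ⟨p * (NumberField.discr K).natAbs * f * f' * W.conductorNorm ℤ *
      (W.quadraticTwist (NumberField.discr K : ℚ)).conductorNorm ℤ, by ring⟩
  have hℓD : ¬ ℓ ∣ (NumberField.discr K).natAbs := fun h => hℓN
    (h.trans ⟨2 * p * f * f' * W.conductorNorm ℤ * (W.quadraticTwist (NumberField.discr K : ℚ)).conductorNorm ℤ, by ring⟩)
  have hℓd : ¬ ((ℓ : ℤ) ∣ NumberField.discr K) := fun h => hℓD (Int.natCast_dvd.mp h)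
  have hℓfD : ℓ.Coprime (f * (NumberField.discr K).natAbs) := by
    refine (Nat.Prime.coprime_iff_not_dvd hℓ).mpr fun h => hℓN (h.trans ?_)
    exact ⟨2 * p * f' * W.conductorNorm ℤ * (W.quadraticTwist (NumberField.discr K : ℚ)).conductorNorm ℤ, by ring⟩
  have hℓW : ¬ ℓ ∣ p * W.conductorNorm ℤ := fun h => hℓN (h.trans
    ⟨2 * (NumberField.discr K).natAbs * f * f' * (W.quadraticTwist (NumberField.discr K : ℚ)).conductorNorm ℤ, by ring⟩)
  have hℓW' : ¬ ℓ ∣ p * (W.quadraticTwist (NumberField.discr K : ℚ)).conductorNorm ℤ := fun h => hℓN (h.trans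
    ⟨2 * (NumberField.discr K).natAbs * f * f' * W.conductorNorm ℤ, by ring⟩)
  -- values of the lifted characters at `ℓ`
  have hΨ : (changeLevel (dvd_mul_right f (NumberField.discr K).natAbs) ψ *
        changeLevel (dvd_mul_left (NumberField.discr K).natAbs f) εK) (ℓ : ZMod (f * (NumberField.discr K).natAbs)) =
      ψ (ℓ : ZMod f) * εK (ℓ : ZMod (NumberField.discr K).natAbs) := by
    rw [MulChar.mul_apply, EisensteinPair.changeLevel_apply_natCast _ ψ hℓfD,
      EisensteinPair.changeLevel_apply_natCast _ εK hℓfD]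
  have hΨinv : (changeLevel (dvd_mul_right f (NumberField.discr K).natAbs) ψ *
        changeLevel (dvd_mul_left (NumberField.discr K).natAbs f) εK)⁻¹ (ℓ : ZMod (f * (NumberField.discr K).natAbs)) =
      ψ⁻¹ (ℓ : ZMod f) * εK (ℓ : ZMod (NumberField.discr K).natAbs) := by
    rw [mul_inv, ← map_inv, ← map_inv, BernoulliUnits.inv_eq_self_of_isKroneckerCharacterOf K hεK, MulChar.mul_apply,
      EisensteinPair.changeLevel_apply_natCast _ ψ⁻¹ hℓfD, EisensteinPair.changeLevel_apply_natCast _ εK hℓfD]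
  -- `‖ε_K(ℓ)‖ ≤ 1` (`ε_K(ℓ) = ±1`)
  have hεnorm : ‖εK (ℓ : ZMod (NumberField.discr K).natAbs)‖ ≤ 1 := by
    rw [hεK.2 ℓ hℓ hℓd]; split_ifs <;> simp
  -- the twist coefficient
  have htw := lFunction_twist_discr_eq_kronecker_mul (p := p) W K hK2 εK hεK ℓ hℓ hℓ2 hℓd
  have h₁ := hss ℓ hℓ hℓW
  have h₂ := hss' ℓ hℓ hℓW'
  rw [htw] at h₂
  rw [hΨ, hΨinv]
  -- `εT − T' = ε·(−(a − T)) + (εa − T')`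
  have e : ψ (ℓ : ZMod f) * εK (ℓ : ZMod (NumberField.discr K).natAbs) +
          ψ⁻¹ (ℓ : ZMod f) * εK (ℓ : ZMod (NumberField.discr K).natAbs) * ω (ℓ : ZMod p) -
        (ψ' (ℓ : ZMod f') + ψ'⁻¹ (ℓ : ZMod f') * ω (ℓ : ZMod p)) =
      εK (ℓ : ZMod (NumberField.discr K).natAbs) *
          -(((W.LFunction ℓ : ℤ) : ℚ_[p]) - (ψ (ℓ : ZMod f) + ψ⁻¹ (ℓ : ZMod f) * ω (ℓ : ZMod p))) +
        (εK (ℓ : ZMod (NumberField.discr K).natAbs) * ((W.LFunction ℓ : ℤ) : ℚ_[p]) -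
          (ψ' (ℓ : ZMod f') + ψ'⁻¹ (ℓ : ZMod f') * ω (ℓ : ZMod p))) := by
    ring
  rw [e]
  refine lt_of_le_of_lt (IsUltrametricDist.norm_add_le_max _ _) (max_lt ?_ h₂)
  rw [norm_mul, norm_neg]
  calc ‖εK (ℓ : ZMod (NumberField.discr K).natAbs)‖ *
        ‖((W.LFunction ℓ : ℤ) : ℚ_[p]) - (ψ (ℓ : ZMod f) + ψ⁻¹ (ℓ : ZMod f) * ω (ℓ : ZMod p))‖
      ≤ 1 * ‖((W.LFunction ℓ : ℤ) : ℚ_[p]) - (ψ (ℓ : ZMod f) + ψ⁻¹ (ℓ : ZMod f) * ω (ℓ : ZMod p))‖ :=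
        mul_le_mul_of_nonneg_right hεnorm (norm_nonneg _)
    _ < 1 := by rw [one_mul]; exact h₁

/-- **THE `K`-FACTOR IS THE CLASS FACTOR OF THE TWIST.** For `W/ℚ` elliptic, `p ≥ 5`, an ODD datum `(f, ψ, ω)` with `ω` Teichmüller and
the trace form `hss` for `W`, an IMAGINARY quadratic `K` with Kronecker character `ε_K` (`IsKroneckerCharacterOf`), and ANY odd datum
`(f', ψ', ω')` with `ω'` Teichmüller and `hss` for the twist `W.quadraticTwist (d_K : ℚ)`:
**`bernoulliOnePrim ψ'⁻¹ = bernoulliOnePrim (bernoulliCharTwo ψ ε_K ω)`** — the twist's class factor `B_{1,ψ'⁻¹}` IS Kriz–Li's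
`K`-factor `B_{1,(ψ₀ω⁻¹)~}`, `ψ₀ = ψε_K`, of the pair `(W, K)`. No Heegner hypothesis, no minimality, no primitivity.
[cite: KrizLi2019, Thm. 1.20 (p. 8), §2 (p. 11), §7.1 (p. 43)] [cite: SilvermanAEC2009, X.2 Prop. 2.4 and Exercise 10.16] -/
theorem classFactor_twist_eq_fieldFactor (W : WeierstrassCurve ℚ) [W.IsElliptic] (h5 : 5 ≤ p)
    {f f' : ℕ} [NeZero f] [NeZero f'] (ψ : DirichletCharacter ℚ_[p] f) (ω : DirichletCharacter ℚ_[p] p)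
    (hψ : ψ.Odd) (hω : IsTeichmullerCharacter ω)
    (hss : ∀ ℓ : ℕ, ℓ.Prime → ¬ (ℓ ∣ p * W.conductorNorm ℤ) →
      ‖((W.LFunction ℓ : ℤ) : ℚ_[p]) - (ψ (ℓ : ZMod f) + ψ⁻¹ (ℓ : ZMod f) * ω (ℓ : ZMod p))‖ < 1)
    (K : Type) [Field K] [NumberField K] (hK : IsImaginaryQuadratic K)
    (εK : DirichletCharacter ℚ_[p] (NumberField.discr K).natAbs) (hεK : IsKroneckerCharacterOf K εK)
    (ψ' : DirichletCharacter ℚ_[p] f') (ω' : DirichletCharacter ℚ_[p] p) (hψ' : ψ'.Odd) (hω' : IsTeichmullerCharacter ω')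
    (hss' : ∀ ℓ : ℕ, ℓ.Prime → ¬ (ℓ ∣ p * (W.quadraticTwist (NumberField.discr K : ℚ)).conductorNorm ℤ) →
      ‖(((W.quadraticTwist (NumberField.discr K : ℚ)).LFunction ℓ : ℤ) : ℚ_[p]) -
        (ψ' (ℓ : ZMod f') + ψ'⁻¹ (ℓ : ZMod f') * ω' (ℓ : ZMod p))‖ < 1) :
    bernoulliOnePrim ψ'⁻¹ = bernoulliOnePrim (bernoulliCharTwo ψ εK ω) := by
  have hp2 : p ≠ 2 := by omega
  obtain rfl : ω = ω' := eq_of_isTeichmullerCharacter hp2 hω hω'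
  have hd0 : NumberField.discr K ≠ 0 := NumberField.discr_ne_zero K
  haveI : NeZero (NumberField.discr K).natAbs := ⟨Int.natAbs_ne_zero.mpr hd0⟩
  haveI hWd : (W.quadraticTwist (NumberField.discr K : ℚ)).IsElliptic :=
    W.isElliptic_quadraticTwist (by exact_mod_cast hd0)
  have hεodd : εK.Odd := BernoulliUnits.odd_of_isKroneckerCharacterOf K hK hεK
  have hne : ¬ ψ.Even := EisensteinPair.not_even_of_odd' ψ hψ
  -- the modulus avoiding all bad primes is non-zero
  have hN0 : 2 * p * (NumberField.discr K).natAbs * f * f' * W.conductorNorm ℤ *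
      (W.quadraticTwist (NumberField.discr K : ℚ)).conductorNorm ℤ ≠ 0 := by
    have h1 : 0 < W.conductorNorm ℤ := W.conductorNorm_pos_holds
    have h2 : 0 < (W.quadraticTwist (NumberField.discr K : ℚ)).conductorNorm ℤ :=
      (W.quadraticTwist (NumberField.discr K : ℚ)).conductorNorm_pos_holds
    exact Nat.mul_ne_zero (Nat.mul_ne_zero (Nat.mul_ne_zero (Nat.mul_ne_zero (Nat.mul_ne_zero (Nat.mul_ne_zero two_ne_zero
      hp.out.ne_zero) (NeZero.ne _)) (NeZero.ne f)) (NeZero.ne f')) h1.ne') h2.ne'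
  -- the common level `M = f·|d_K|·p·f'`
  haveI : NeZero (f * (NumberField.discr K).natAbs * p * f') :=
    ⟨Nat.mul_ne_zero (Nat.mul_ne_zero (Nat.mul_ne_zero (NeZero.ne f) (NeZero.ne _)) hp.out.ne_zero) (NeZero.ne f')⟩
  have h₁ : f * (NumberField.discr K).natAbs ∣ f * (NumberField.discr K).natAbs * p * f' := ⟨p * f', by ring⟩
  have h₂ : f' ∣ f * (NumberField.discr K).natAbs * p * f' := dvd_mul_left f' _
  have hpM : p ∣ f * (NumberField.discr K).natAbs * p * f' := ⟨f * (NumberField.discr K).natAbs * f', by ring⟩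
  have h₃ : f * (NumberField.discr K).natAbs * p ∣ f * (NumberField.discr K).natAbs * p * f' := dvd_mul_right _ f'
  -- `ψ₀ = evenTwist ψ ε_K = ψ↑·ε_K↑` for odd `ψ`
  have hET : evenTwist ψ εK = changeLevel (dvd_mul_right f (NumberField.discr K).natAbs) ψ *
      changeLevel (dvd_mul_left (NumberField.discr K).natAbs f) εK := by
    unfold evenTwist; rw [if_neg hne]
  have hcongr := traceForm_congr_evenTwist_of_hss_twist (p := p) W K hK.1 ψ ψ' ω εK hεK hss hss'
  rw [← hET] at hcongr
  rcases EisensteinPair.eq_or_eq_of_traceForm_congr hp2 h₁ h₂ hpM (evenTwist ψ εK) ψ' ω hN0 hcongr with e | e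
  · -- parity: `ψ'` odd, `ψ₀ = ψ·ε_K` even
    exfalso
    have h1 := congrArg (fun χ : DirichletCharacter ℚ_[p] (f * (NumberField.discr K).natAbs * p * f') => χ (-1)) e
    simp only [EisensteinPair.changeLevel_apply_neg_one] at h1
    rw [hψ', hET, MulChar.mul_apply, EisensteinPair.changeLevel_apply_neg_one, EisensteinPair.changeLevel_apply_neg_one,
      hψ, hεodd] at h1
    have h2 : (2 : ℚ_[p]) = 0 := by linear_combination -h1
    exact two_ne_zero h2
  · -- `ψ'↑ = ψ₀⁻¹↑·ω↑`; invert and read `bernoulliOnePrim` on the primitive character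
    have E1 : changeLevel h₂ ψ'⁻¹ = changeLevel h₁ (evenTwist ψ εK) * changeLevel hpM ω⁻¹ := by
      rw [map_inv, e, mul_inv, ← map_inv, inv_inv, ← map_inv]
    have E2 : changeLevel h₃ (bernoulliCharTwo ψ εK ω) = changeLevel h₁ (evenTwist ψ εK) * changeLevel hpM ω⁻¹ := by
      unfold bernoulliCharTwo
      rw [map_mul, ← changeLevel_trans, ← changeLevel_trans]
    calc bernoulliOnePrim ψ'⁻¹ = bernoulliOnePrim (changeLevel h₂ ψ'⁻¹) :=
          (RegularLocusBernoulliPair.bernoulliOnePrim_changeLevel h₂ ψ'⁻¹).symm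
      _ = bernoulliOnePrim (changeLevel h₃ (bernoulliCharTwo ψ εK ω)) := by rw [E1, E2]
      _ = bernoulliOnePrim (bernoulliCharTwo ψ εK ω) := RegularLocusBernoulliPair.bernoulliOnePrim_changeLevel h₃ _

end Summit.BirchSwinnertonDyer.BirchSwinnertonDyer.Theorems.PrintCFram.OffLocusTwistFactor

end
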